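import Literature.NumberTheory.EllipticCurves.CPMuDescentBoxes
import Literature.NumberTheory.NumberFields.EisensteinFieldSelmerNormCubeInert
import HarnessLib

/-!
# The `α̂`-box over `ℚ(√−3)` of the `3`-isogeny descent from one generator, and `t_3(E_{m,s}) = 0` booked
# from generators on both sides (Cohen–Pazuki 2009, Thm. 2.1, Prop. 2.2) — generic in `E_{m,s}/ℚ`

Topic `NumberTheory/EllipticCurves`. Curve-independent form of `Curve6137PhiSideK3`. Over `K3 = ℚ(ζ₃)` the
`ℤ/3`-kernel side of the descent of `E = threeTorsionModel m s` is the `μ₃`-descent of the Cohen–Pazuki pair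
`V₃ = cpCurve a₃ b₃ = E_{K3} → Ê₃ = threeTorsionModel m₃ s₃` (`t m₃ = 3a₃`, `t³ s₃ = 4a₃³ + 9b₃`); a torsor
class `[C_u]`, `u ∈ K3*` of cube NORM, lying in `Ш(E/K3)` has `3 ∣ ord_w(u)` at every place `w ∌ 3N` where
`2s₃` is a unit and `2m₃` is integral (local necessity, `CPMuDescentLocal` + the valuation lemma), hence —
when the prime factors of `N` are INERT — `[u] ∈ {[1], [ζ], [ζ²]}` (`EisensteinFieldSelmerNormCubeInert`);
so if `[ζ]` is a descent class of a point of `Ê₃` (ONE generator, `hgen`) the class `[C_u]` vanishes: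

* **`torsorClass_eq_zero_of_mem_sha_of_norm_cube_of_gen`** — the `K3`-box statement `hbox` of
  `CPMuDescentPhiSide` / `CPMuDescentBoxes` from: `N` (inert support), the two valuation conditions at
  `w ∌ 3N`, and `[ζ] ∈ ⟨[α̂(P)] : P ∈ Ê₃(K3)⟩`;
* `valuation_theta0_eq_one_of_not_mem`, `valuation_natCast_eq_one_of_dvd_pow`,
  `valuation_algebraMap_eq_one_of_eq_div`, `valuation_algebraMap_le_one_of_eq_div` — dischargers for the
  valuation conditions from divisibility in `ℕ`;
* the CANONICAL pair over `K3` for `E_{m,s}`: `a₃ = −(m/3)θ₀`, `b₃ = −(s/3)θ₀`, `t = −1`, `m₃ = mθ₀`,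
  `s₃ = b̂θ₀` (`b̂ = 3s − 4m³/9`), `Ê₃ = threeTorsionModel (mθ₀) (b̂θ₀) = V_{K3}` (`canonical₃_*`);
* **`shaCorank_three_eq_zero_of_gens`** — `t_3(E_{m,s}) = 0` BOOKED from: `S` + one `[p] = [α(P)]` per `p ∈ S`
  (the `α`-box over `ℚ`), `N` inert with `w(2b̂) = 1`, `w(2m) ≤ 1` off `3N`, and `[ζ] ∈ ⟨[α̂(P)]⟩` for each
  square root `θ₀` of `−3` (the `α̂`-box over `K3`). This is the form in which further cross-prime cells at `3`
  of route ShaPrimaryTransfer are to be certified.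

## References

* [CohenPazuki2009] H. Cohen, F. Pazuki, Acta Arith. 140 (2009), Def. 1.3, Thm. 2.1, Prop. 2.2.
* [SilvermanAEC2009] J. H. Silverman, *AEC*, Thm. X.4.2 (a), Prop. VIII.1.6.
-/

noncomputable section

open scoped Classical

open WeierstrassCurve IsDedekindDomain IsDedekindDomain.HeightOneSpectrum NumberField

namespace Literature.NumberTheory.EllipticCurves

namespace CPMuDescent

open MordellDescent ThreeTorsionDescent MuThreeKernel WithZero
open Literature.NumberTheory.NumberFields Literature.NumberTheory.NumberFields.K3

/-! ## Valuation dischargers over `K3` -/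

/-- `w(A) = 1` for a natural number `A ∣ D^k` at a place `w ∌ D`. [cite: CohenPazuki2009, Theorem 2.1 (2)] -/
theorem valuation_natCast_eq_one_of_dvd_pow {w : HeightOneSpectrum (𝓞 K3)} {D : ℕ}
    (hw : ((D : ℕ) : 𝓞 K3) ∉ w.asIdeal) {A k : ℕ} (hA : A ∣ D ^ k) : w.valuation K3 (A : K3) = 1 := by
  have hDk : (((D ^ k : ℕ) : 𝓞 K3)) ∉ w.asIdeal := by
    rw [Nat.cast_pow]
    exact fun h => hw (w.isPrime.mem_of_pow_mem _ h)
  have h := K3.valuation_coe_eq_one_of_dvd w hDk (y := ((A : ℕ) : 𝓞 K3)) (map_dvd (Nat.castRingHom (𝓞 K3)) hA)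
  rwa [coe_natCast_ringOfIntegers] at h

/-- `w(A) ≤ 1` for a natural number `A`. [cite: CohenPazuki2009, Theorem 2.1 (2)] -/
theorem valuation_natCast_le_one (w : HeightOneSpectrum (𝓞 K3)) (A : ℕ) : w.valuation K3 (A : K3) ≤ 1 := by
  have := IsDedekindDomain.HeightOneSpectrum.valuation_le_one (K := K3) w ((A : ℕ) : 𝓞 K3)
  exact_mod_cast this

/-- `w(x) = 1` for a rational `x = ±A/B` with `A, B ∣ D^k`, at `w ∌ D`. [cite: CohenPazuki2009, Theorem 2.1 (2)] -/
theorem valuation_algebraMap_eq_one_of_eq_div {w : HeightOneSpectrum (𝓞 K3)} {D : ℕ}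
    (hw : ((D : ℕ) : 𝓞 K3) ∉ w.asIdeal) {x : ℚ} {A B k : ℕ} (hA : A ∣ D ^ k) (hB : B ∣ D ^ k)
    (hx : x = A / B ∨ x = -(A / B)) : w.valuation K3 (algebraMap ℚ K3 x) = 1 := by
  have hA1 := valuation_natCast_eq_one_of_dvd_pow hw hA
  have hB1 := valuation_natCast_eq_one_of_dvd_pow hw hB
  have e : w.valuation K3 (algebraMap ℚ K3 (A / B)) = 1 := by
    rw [map_div₀, map_natCast, map_natCast, map_div₀, hA1, hB1, div_one]
  rcases hx with rfl | rfl
  · exact e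
  · rw [map_neg, Valuation.map_neg, e]

/-- `w(x) ≤ 1` for a rational `x = ±A/B` with `B ∣ D^k`, at `w ∌ D`. [cite: CohenPazuki2009, Theorem 2.1 (2)] -/
theorem valuation_algebraMap_le_one_of_eq_div {w : HeightOneSpectrum (𝓞 K3)} {D : ℕ}
    (hw : ((D : ℕ) : 𝓞 K3) ∉ w.asIdeal) {x : ℚ} {A B k : ℕ} (hB : B ∣ D ^ k)
    (hx : x = A / B ∨ x = -(A / B)) : w.valuation K3 (algebraMap ℚ K3 x) ≤ 1 := by
  have hA1 := valuation_natCast_le_one w A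
  have hB1 := valuation_natCast_eq_one_of_dvd_pow hw hB
  have e : w.valuation K3 (algebraMap ℚ K3 (A / B)) ≤ 1 := by
    rw [map_div₀, map_natCast, map_natCast, map_div₀, hB1, div_one]; exact hA1
  rcases hx with rfl | rfl
  · exact e
  · rw [map_neg, Valuation.map_neg]; exact e

/-- `w(θ₀) = 1` at `w ∌ 3N` for `θ₀² = −3`. [cite: CohenPazuki2009, Theorem 2.1 (2)] -/
theorem valuation_theta0_eq_one_of_not_mem {θ₀ : K3} (hθ : θ₀ ^ 2 = -3) {N : ℕ} {w : HeightOneSpectrum (𝓞 K3)}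
    (hw : ((3 * N : ℕ) : 𝓞 K3) ∉ w.asIdeal) : w.valuation K3 θ₀ = 1 := by
  have h3 : w.valuation K3 (3 : K3) = 1 := by
    have := valuation_natCast_eq_one_of_dvd_pow hw (A := 3) (k := 1) (by rw [pow_one]; exact dvd_mul_right 3 N)
    simpa using this
  have h : (w.valuation K3 θ₀) ^ 2 = 1 := by
    rw [← Valuation.map_pow, hθ, Valuation.map_neg, h3]
  exact (pow_eq_one_iff.mp h).resolve_right two_ne_zero

/-! ## The `K3`-box from one generator -/

/-- `[ζ^i] ∈ G` once `[ζ] ∈ G` (private). [cite: CohenPazuki2009, Proposition 2.2] -/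
private theorem cubeClass_zeta_pow_mem {G : Subgroup (CubeUnits K3)} (h : cubeClass (zeta : K3) ∈ G) (i : ℕ) :
    cubeClass ((zeta : K3) ^ i) ∈ G := by
  have hz : (zeta : K3) ≠ 0 := isPrimitiveRoot_zeta.ne_zero (by norm_num)
  induction i with
  | zero => rw [pow_zero, cubeClass_one]; exact G.one_mem
  | succ n ih => rw [pow_succ, cubeClass_mul (pow_ne_zero _ hz) hz]; exact G.mul_mem ih h

/-- **The `α̂`-box over `K3` from one generator.** For a Cohen–Pazuki pair `cpCurve a₃ b₃ → threeTorsionModel m₃ s₃`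
over `K3` (`t m₃ = 3a₃`, `t³ s₃ = 4a₃³ + 9b₃`), an `N ≠ 0` whose prime factors are `2` or `≡ 2 (mod 3)` with
`w(2s₃) = 1`, `w(2m₃) ≤ 1` at every `w ∌ 3N`, and `[ζ] ∈ ⟨[α̂(P)] : P ∈ Ê₃(K3)⟩`: every `μ₃`-torsor class `[C_u]`,
`u` of cube norm, lying in `Ш(V₃/K3)` vanishes. [cite: CohenPazuki2009, Theorem 2.1 and Proposition 2.2] -/
theorem torsorClass_eq_zero_of_mem_sha_of_norm_cube_of_gen {N : ℕ} (hN0 : N ≠ 0)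
    (hN : ∀ q ∈ N.primeFactors, q = 2 ∨ q % 3 = 2) {a₃ b₃ t m₃ s₃ : K3} (hb₃ : b₃ ≠ 0)
    (hd₃ : 4 * a₃ ^ 3 + 9 * b₃ ≠ 0) (ht : t ≠ 0) (hm₃ : t * m₃ = 3 * a₃) (hs₃ : t ^ 3 * s₃ = 4 * a₃ ^ 3 + 9 * b₃)
    (hvs : ∀ w : HeightOneSpectrum (𝓞 K3), ((3 * N : ℕ) : 𝓞 K3) ∉ w.asIdeal → w.valuation K3 (2 * s₃) = 1)
    (hvm : ∀ w : HeightOneSpectrum (𝓞 K3), ((3 * N : ℕ) : 𝓞 K3) ∉ w.asIdeal → w.valuation K3 (2 * m₃) ≤ 1)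
    (hgen : cubeClass (zeta : K3) ∈ Subgroup.closure (Set.range
      fun P : (threeTorsionModel m₃ s₃).toAffine.Point => descentClass (threeTorsionModel m₃ s₃) m₃ s₃ P))
    {u : K3} (hu : u ≠ 0) (hsha : (kernelDatum hb₃ hd₃).torsorClass hu ∈ (cpCurve a₃ b₃).sha)
    (hnorm : ∃ r : ℚ, QuadraticAlgebra.norm u = r ^ 3) : (kernelDatum hb₃ hd₃).torsorClass hu = 0 := by
  have hval : ∀ w : HeightOneSpectrum (𝓞 K3), ((3 * N : ℕ) : 𝓞 K3) ∉ w.asIdeal →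
      (3 : ℤ) ∣ log (w.valuation K3 u) := by
    intro w hw
    obtain ⟨P, w', e, hw', hP⟩ :=
      exists_descent_pow_eq_adicCompletion_of_torsorClass_mem_sha hb₃ hd₃ ht hm₃ hs₃ hu hsha w
    have hval' : ∀ x : K3, Valued.v (algebraMap K3 (w.adicCompletion K3) x) = w.valuation K3 x :=
      fun x => valuedAdicCompletion_eq_valuation' w x
    have key := Carrier6137.three_dvd_log_of_descent_pow_eq' Valued.v (algebraMap K3 (w.adicCompletion K3))
      (by rw [hval']; exact hvs w hw) (by rw [hval']; exact hvm w hw) hu hw' hP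
    rwa [hval'] at key
  obtain ⟨i, -, hi⟩ := K3.exists_cubeClass_eq_zeta_pow_of_norm_cube_inert hN0 hN hu hval hnorm
  rw [(kernelDatum hb₃ hd₃).torsorClass_eq_zero_iff_cubeClass_mem_ker hu, hi, MonoidHom.mem_ker]
  exact torsorClassQuotHom_eq_one_of_mem_closure hb₃ hd₃ ht hm₃ hs₃ (cubeClass_zeta_pow_mem hgen i)

/-! ## The canonical Cohen–Pazuki pair over `K3` of `E_{m,s}` -/

section Canonical

variable {m s : ℚ} {θ₀ : K3} (hθ : θ₀ ^ 2 = -3)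
include hθ

/-- `θ₀³ = −3θ₀`. [cite: CohenPazuki2009, §1.2] -/
theorem canonical₃_theta0_cube : θ₀ ^ 3 = -3 * θ₀ := by rw [pow_succ, hθ]

/-- `b₃ = −(s/3)θ₀ ≠ 0` when `E_{m,s}` is elliptic. [cite: CohenPazuki2009, §1.2] -/
theorem canonical₃_b_ne_zero [hE : (threeTorsionModel m s).IsElliptic] :
    -(algebraMap ℚ K3 s / 3) * θ₀ ≠ 0 := by
  have hs : s ≠ 0 := by
    have h := (isElliptic_threeTorsionModel_iff m s).mp hE
    intro h0; apply h; rw [h0]; ring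
  refine mul_ne_zero (neg_ne_zero.mpr (div_ne_zero ?_ (by norm_num))) (Carrier6137.theta0_ne_zero hθ)
  exact (map_ne_zero (algebraMap ℚ K3)).mpr hs

/-- `4a₃³ + 9b₃ = −b̂θ₀ ≠ 0` (`b̂ = 3s − 4m³/9`) when `E_{m,s}` is elliptic. [cite: CohenPazuki2009, §1.2] -/
theorem canonical₃_d_ne_zero [(threeTorsionModel m s).IsElliptic] :
    4 * (-(algebraMap ℚ K3 m / 3) * θ₀) ^ 3 + 9 * (-(algebraMap ℚ K3 s / 3) * θ₀) ≠ 0 := by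
  have e : 4 * (-(algebraMap ℚ K3 m / 3) * θ₀) ^ 3 + 9 * (-(algebraMap ℚ K3 s / 3) * θ₀) =
      -(algebraMap ℚ K3 (3 * s - 4 * m ^ 3 / 9)) * θ₀ := by
    rw [map_sub, map_mul, map_div₀, map_mul, map_pow, map_ofNat, map_ofNat, map_ofNat]
    linear_combination (-(4 : K3) / 27 * (algebraMap ℚ K3 m) ^ 3) * canonical₃_theta0_cube hθ
  rw [e]
  exact mul_ne_zero (neg_ne_zero.mpr ((map_ne_zero (algebraMap ℚ K3)).mpr canonical_b_ne_zero))
    (Carrier6137.theta0_ne_zero hθ)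

omit hθ in
/-- `t = −1`: `(−1)·(mθ₀) = 3a₃`. [cite: CohenPazuki2009, Definition 1.3] -/
theorem canonical₃_hm : (-1 : K3) * (algebraMap ℚ K3 m * θ₀) = 3 * (-(algebraMap ℚ K3 m / 3) * θ₀) := by ring

/-- `t = −1`: `(−1)³·(b̂θ₀) = 4a₃³ + 9b₃`. [cite: CohenPazuki2009, Definition 1.3] -/
theorem canonical₃_hs : (-1 : K3) ^ 3 * (algebraMap ℚ K3 (3 * s - 4 * m ^ 3 / 9) * θ₀) =
    4 * (-(algebraMap ℚ K3 m / 3) * θ₀) ^ 3 + 9 * (-(algebraMap ℚ K3 s / 3) * θ₀) := by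
  rw [map_sub, map_mul, map_div₀, map_mul, map_pow, map_ofNat, map_ofNat, map_ofNat]
  linear_combination ((4 : K3) / 27 * (algebraMap ℚ K3 m) ^ 3) * canonical₃_theta0_cube hθ

/-- `E_{K3} = cpCurve a₃ b₃`. [cite: CohenPazuki2009, §1.2] -/
theorem canonical₃_baseChange_eq :
    (threeTorsionModel m s).baseChange K3 = cpCurve (-(algebraMap ℚ K3 m / 3) * θ₀) (-(algebraMap ℚ K3 s / 3) * θ₀) := by
  rw [WeierstrassCurve.baseChange, map_threeTorsionModel]
  refine WeierstrassCurve.ext rfl ?_ rfl ?_ ?_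
  · simp only [cpCurve_a₂, threeTorsionModel_a₂]
    linear_combination ((algebraMap ℚ K3 m) ^ 2 / 3) * hθ
  · simp only [cpCurve_a₄, threeTorsionModel_a₄]
    linear_combination ((2 : K3) / 3 * algebraMap ℚ K3 m * algebraMap ℚ K3 s) * hθ
  · simp only [cpCurve_a₆, threeTorsionModel_a₆]
    linear_combination ((algebraMap ℚ K3 s) ^ 2 / 3) * hθ

/-- `b₃θ₀ = s`. [cite: CohenPazuki2009, §1.2] -/
theorem canonical₃_hy : -(algebraMap ℚ K3 s / 3) * θ₀ * θ₀ = algebraMap ℚ K3 s := by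
  linear_combination (-(algebraMap ℚ K3 s) / 3) * hθ

/-- `w(2s₃) = w(2b̂θ₀) = 1` at `w ∌ 3N` from `w(2b̂) = 1`. [cite: CohenPazuki2009, Theorem 2.1 (2)] -/
theorem canonical₃_valuation_s {N : ℕ} {w : HeightOneSpectrum (𝓞 K3)} (hw : ((3 * N : ℕ) : 𝓞 K3) ∉ w.asIdeal)
    (hvb : w.valuation K3 (algebraMap ℚ K3 (2 * (3 * s - 4 * m ^ 3 / 9))) = 1) :
    w.valuation K3 (2 * (algebraMap ℚ K3 (3 * s - 4 * m ^ 3 / 9) * θ₀)) = 1 := by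
  rw [← mul_assoc, show (2 : K3) * algebraMap ℚ K3 (3 * s - 4 * m ^ 3 / 9) =
    algebraMap ℚ K3 (2 * (3 * s - 4 * m ^ 3 / 9)) by rw [map_mul, map_ofNat], Valuation.map_mul, hvb,
    valuation_theta0_eq_one_of_not_mem hθ hw, one_mul]

/-- `w(2m₃) = w(2mθ₀) ≤ 1` at `w ∌ 3N` from `w(2m) ≤ 1`. [cite: CohenPazuki2009, Theorem 2.1 (2)] -/
theorem canonical₃_valuation_m {N : ℕ} {w : HeightOneSpectrum (𝓞 K3)} (hw : ((3 * N : ℕ) : 𝓞 K3) ∉ w.asIdeal)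
    (hvm : w.valuation K3 (algebraMap ℚ K3 (2 * m)) ≤ 1) :
    w.valuation K3 (2 * (algebraMap ℚ K3 m * θ₀)) ≤ 1 := by
  rw [← mul_assoc, show (2 : K3) * algebraMap ℚ K3 m = algebraMap ℚ K3 (2 * m) by rw [map_mul, map_ofNat],
    Valuation.map_mul, valuation_theta0_eq_one_of_not_mem hθ hw, mul_one]
  exact hvm

end Canonical

/-! ## Booking a cross-prime cell at `3`: `t_3(E_{m,s}) = 0` from generators on both sides -/

/-- **`Ш(E/ℚ)[3] = 0` for `E = threeTorsionModel m s` from generators on both sides.** Inputs: (ℚ-side) a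
finite set of primes `S` outside which `v_p(2s) = 0 ≤ v_p(2m)`, and `[p] ∈ ⟨[α(P)] : P ∈ E(ℚ)⟩` for every
`p ∈ S`; (`K3`-side) `N ≠ 0` with inert prime factors such that `w(2b̂) = 1`, `w(2m) ≤ 1` at every place
`w ∌ 3N` of `K3` (`b̂ = 3s − 4m³/9`), and, for each `θ₀ = ±√−3 ∈ K3`, `[ζ] ∈ ⟨[α̂(P)] : P ∈ Ê₃(K3)⟩` for
`Ê₃ = threeTorsionModel (mθ₀) (b̂θ₀)` (`= V_{K3}`, `V = cpCurve m b̂ ≅ Ê`; `α̂ = y − θ₀(mx + b̂)`).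
[cite: CohenPazuki2009, Proposition 2.2] [cite: SilvermanAEC2009, Thm. X.4.2 (a)] -/
theorem forall_mem_sha_three_nsmul_eq_zero_of_gens {m s : ℚ} [(threeTorsionModel m s).IsElliptic]
    (S : Finset ℕ) (hS : ∀ p ∈ S, p.Prime)
    (hout : ∀ p : ℕ, p.Prime → p ∉ S → padicValRat p (2 * s) = 0 ∧ 0 ≤ padicValRat p (2 * m))
    (hgen : ∀ p ∈ S, cubeClass (p : ℚ) ∈ Subgroup.closure (Set.range
      fun P : (threeTorsionModel m s).toAffine.Point => descentClass (threeTorsionModel m s) m s P))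
    {N : ℕ} (hN0 : N ≠ 0) (hN : ∀ q ∈ N.primeFactors, q = 2 ∨ q % 3 = 2)
    (hvb : ∀ w : HeightOneSpectrum (𝓞 K3), ((3 * N : ℕ) : 𝓞 K3) ∉ w.asIdeal →
      w.valuation K3 (algebraMap ℚ K3 (2 * (3 * s - 4 * m ^ 3 / 9))) = 1)
    (hvm : ∀ w : HeightOneSpectrum (𝓞 K3), ((3 * N : ℕ) : 𝓞 K3) ∉ w.asIdeal →
      w.valuation K3 (algebraMap ℚ K3 (2 * m)) ≤ 1)
    (hgen₃ : ∀ θ₀ : K3, θ₀ ^ 2 = -3 → cubeClass (zeta : K3) ∈ Subgroup.closure (Set.range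
      fun P : (threeTorsionModel (algebraMap ℚ K3 m * θ₀) (algebraMap ℚ K3 (3 * s - 4 * m ^ 3 / 9) * θ₀)).toAffine.Point =>
        descentClass (threeTorsionModel (algebraMap ℚ K3 m * θ₀) (algebraMap ℚ K3 (3 * s - 4 * m ^ 3 / 9) * θ₀))
          (algebraMap ℚ K3 m * θ₀) (algebraMap ℚ K3 (3 * s - 4 * m ^ 3 / 9) * θ₀) P)) :
    ∀ c ∈ (threeTorsionModel m s).sha, 3 • c = 0 → c = 0 :=
  forall_mem_sha_three_nsmul_eq_zero_of_gens_of_box S hS hout hgen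
    (fun θ₀ => -(algebraMap ℚ K3 m / 3) * θ₀) (fun θ₀ => -(algebraMap ℚ K3 s / 3) * θ₀)
    (fun _ hθ => canonical₃_b_ne_zero (m := m) hθ) (fun _ hθ => canonical₃_d_ne_zero hθ)
    (fun _ hθ => canonical₃_baseChange_eq hθ) (fun _ hθ => canonical₃_hy hθ)
    (fun θ₀ hθ _ hu hsha hnorm => torsorClass_eq_zero_of_mem_sha_of_norm_cube_of_gen hN0 hN
      (canonical₃_b_ne_zero (m := m) hθ) (canonical₃_d_ne_zero hθ) (t := -1) (by norm_num) canonical₃_hm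
      (canonical₃_hs hθ) (fun w hw => canonical₃_valuation_s hθ hw (hvb w hw))
      (fun w hw => canonical₃_valuation_m hθ hw (hvm w hw)) (hgen₃ θ₀ hθ) hu hsha hnorm)

/-- **`t_3(E_{m,s}) = corank_{ℤ₃} Ш(E/ℚ)[3^∞] = 0` BOOKED from generators on both sides** (the `α`-box over `ℚ`
from `S` and one rational point per `p ∈ S`; the `α̂`-box over `ℚ(√−3)` from the inert support `N` and one point
with class `[ζ]` per sign of `θ₀`). [cite: CohenPazuki2009, Proposition 2.2] [cite: SilvermanAEC2009, Thm. X.4.2 (a)] -/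
theorem shaCorank_three_eq_zero_of_gens {m s : ℚ} [(threeTorsionModel m s).IsElliptic]
    (S : Finset ℕ) (hS : ∀ p ∈ S, p.Prime)
    (hout : ∀ p : ℕ, p.Prime → p ∉ S → padicValRat p (2 * s) = 0 ∧ 0 ≤ padicValRat p (2 * m))
    (hgen : ∀ p ∈ S, cubeClass (p : ℚ) ∈ Subgroup.closure (Set.range
      fun P : (threeTorsionModel m s).toAffine.Point => descentClass (threeTorsionModel m s) m s P))
    {N : ℕ} (hN0 : N ≠ 0) (hN : ∀ q ∈ N.primeFactors, q = 2 ∨ q % 3 = 2)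
    (hvb : ∀ w : HeightOneSpectrum (𝓞 K3), ((3 * N : ℕ) : 𝓞 K3) ∉ w.asIdeal →
      w.valuation K3 (algebraMap ℚ K3 (2 * (3 * s - 4 * m ^ 3 / 9))) = 1)
    (hvm : ∀ w : HeightOneSpectrum (𝓞 K3), ((3 * N : ℕ) : 𝓞 K3) ∉ w.asIdeal →
      w.valuation K3 (algebraMap ℚ K3 (2 * m)) ≤ 1)
    (hgen₃ : ∀ θ₀ : K3, θ₀ ^ 2 = -3 → cubeClass (zeta : K3) ∈ Subgroup.closure (Set.range
      fun P : (threeTorsionModel (algebraMap ℚ K3 m * θ₀) (algebraMap ℚ K3 (3 * s - 4 * m ^ 3 / 9) * θ₀)).toAffine.Point =>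
        descentClass (threeTorsionModel (algebraMap ℚ K3 m * θ₀) (algebraMap ℚ K3 (3 * s - 4 * m ^ 3 / 9) * θ₀))
          (algebraMap ℚ K3 m * θ₀) (algebraMap ℚ K3 (3 * s - 4 * m ^ 3 / 9) * θ₀) P)) :
    (threeTorsionModel m s).shaCorank 3 = 0 :=
  haveI : Fact (Nat.Prime 3) := ⟨Nat.prime_three⟩
  shaCorank_eq_zero_of_forall _ 3 (forall_mem_sha_three_nsmul_eq_zero_of_gens S hS hout hgen hN0 hN hvb hvm hgen₃)

end CPMuDescent

end Literature.NumberTheory.EllipticCurves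

end
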